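import Literature.AnabelianGeometry.AbsoluteAnabelian.NumberFieldValuationProSetDecomposition
import Literature.AnabelianGeometry.AbsoluteAnabelian.MLFGaloisGroupsHolds
import Literature.AnabelianGeometry.AbsoluteAnabelian.MLFResidueCardBridgeProofs
import Literature.NumberTheory.NumberFields.RescaledCompletion
import Literature.NumberTheory.Automorphic.AdicCompletionResidueCard
import HarnessLib

/-!
# Neukirch–Uchida, step «local invariants»: an isomorphism of decomposition groups preserves the residue
# characteristic, the local degree, the residue cardinality, hence `e` and `f`

J. Neukirch, A. Schmidt, K. Wingberg, *Cohomology of Number Fields* (2nd ed. 2008), Ch. XII §1–§2: in the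
deduction of the Neukirch–Uchida theorem (12.2.1) from Neukirch's local correspondence (12.1.9), once a
topological isomorphism `α : U₁ ⥲ U₂` of open subgroups of absolute Galois groups of number fields is known to
carry decomposition groups to decomposition groups, the LOCAL anabelian invariants of S. Mochizuki, *The absolute
anabelian geometry of hyperbolic curves* (2004) [AbsAnab], Prop. 1.2.1 (i), (v) p. 10 («`p₁ = p₂`»,
«`[K₁ : ℚ_{p₁}] = [K₂ : ℚ_{p₂}]`, `[k₁ : 𝔽_{p₁}] = [k₂ : 𝔽_{p₂}]`») transfer along `α` the residue
characteristic, the local degree `n_v = e_v f_v` and the residue degree of every finite place — the input of the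
arithmetic-equivalence / Bauer step.

abc-iut cell, campaign L, GAP row G-L4d2g4-1, sub-DAG `plan/L4/SUBDAG-NeukirchUchida.md` (holder abc-iut-L4-d2)
row **R2 LOCAL-INVARIANTS** (abc-iut-w5-d116, L4-lead 12:54Z).  PROOF-ONLY (no definition, no named fact,
no `sorry`), stated INTRINSICALLY for an abstract number field `F` and a nontrivial valuation subring `A` of
`F̄` lying over the finite place `v` (witnessed, as everywhere in the tree, by a prime `𝔓` of `\bar ℤ_F` above `v`
with `𝔓 = 𝔪_A ∩ \bar ℤ_F`: the output shape of abc-iut-L4-d2's `exists_ideal_mem_primesAbove_of_ne_top`), so that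
rows R0 (transport `Γ_K ≅ K.fixingSubgroup`) and R1 (prime correspondence) compose with it by name:

* `ringChar_residueField_adicCompletion`, `eq_of_prime_natCast_mem_asIdeal` — the residue characteristic of
  `F_v` is THE rational prime under `v`;
* `nonempty_continuousMulEquiv_decompositionGroupNF_of_mem_primesAbove` — **`Γ_{F_v} ≃ₜ* G_A` with `v`
  PINNED** as the place under `A` (abc-iut-L4-d2's `exists_continuousMulEquiv_decompositionGroupNF` gives
  `∃ v`; same proof, the place exposed);
* for two number fields `F₁, F₂`, valuation subrings `A₁, A₂` over `v₁, v₂`, and ANY topological isomorphism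
  `α : G_{A₁} ≃ₜ* G_{A₂}` of the decomposition groups:
  `natCast_mem_asIdeal_iff_of_decompositionGroupNF_equiv` (**residue characteristics agree**, (P3)),
  `localDeg_eq_of_decompositionGroupNF_equiv` (**`n_{v₁} = n_{v₂}`**), `residueCard_eq_of_decompositionGroupNF_equiv`
  (**`𝐍 v₁ = 𝐍 v₂`**), `inertiaDeg_eq_of_decompositionGroupNF_equiv` (**`f₁ = f₂`**),
  `ramificationIdx_eq_of_decompositionGroupNF_equiv` (**`e₁ = e₂`**) — (P4).

Inputs, all PROVED in the tree: [AbsAnab] Prop. 1.2.1 (i)/(v) `galoisMLF_iso_residueChar_eq_holds`,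
`galoisMLF_iso_degrees_holds` (abc-iut-L4-t4/t11), at the canonical `ℚ_p`-algebra structure of `F_v`
(`LocalField.adicCompletionPadicAlgebra`, `localDeg_eq_finrank`), the residue-cardinality bridges
`residueCardMLF_eq_residueFieldCard` / `residueFieldCard_adicCompletion_eq`, and `D_𝔓 = res(Γ_{F_v})`
(`decompositionSubgroup_adicCompletionPrime_eq_range`, Neukirch II (9.6)).  HONEST FRAMING: classical algebraic
number theory; nothing here bears on [IUTchIII] Cor. 3.12 or takes a side.
-/

noncomputable section

open scoped NumberField Pointwise
open Field IsDedekindDomain ValuativeRel Literature.NumberTheory.GaloisRepresentations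
open Literature.NumberTheory.GaloisRepresentations.IsNonarchimedeanLocalField
open Literature.NumberTheory.NumberFields

namespace Literature.AnabelianGeometry.AbsoluteAnabelian

namespace NeukirchUchidaProof

/-! ### The residue characteristic of `F_v` -/

section ResidueChar

variable {F : Type} [Field F] [NumberField F] (v : HeightOneSpectrum (𝓞 F))

omit [NumberField F] in
/-- A maximal ideal of `𝓞_F` contains exactly one rational prime. [cite: NeukirchANT1999, Ch. I §8 Prop. (8.3)] -/
theorem eq_of_prime_natCast_mem_asIdeal {p q : ℕ} (hp : p.Prime) (hq : q.Prime)
    (hpv : (p : 𝓞 F) ∈ v.asIdeal) (hqv : (q : 𝓞 F) ∈ v.asIdeal) : p = q := by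
  by_contra hne
  have hcop : Nat.Coprime p q := (Nat.coprime_primes hp hq).mpr hne
  obtain ⟨a, b, hab⟩ := Nat.isCoprime_iff_coprime.mpr hcop
  have h1 : (1 : 𝓞 F) ∈ v.asIdeal := by
    have : ((a * p + b * q : ℤ) : 𝓞 F) = 1 := by rw [hab]; simp
    rw [← this]
    push_cast
    exact v.asIdeal.add_mem (v.asIdeal.mul_mem_left _ hpv) (v.asIdeal.mul_mem_left _ hqv)
  exact v.isPrime.ne_top ((Ideal.eq_top_iff_one _).mpr h1)

/-- **The residue characteristic of `F_v` is the rational prime under `v`**: for `p ∈ 𝔭_v` the residue field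
of the `ValuativeRel` valuation ring of the completion `F_v` has characteristic `p` (`|p|_v < 1`).
[cite: NeukirchANT1999, Ch. II Prop. (5.2)] -/
theorem ringChar_residueField_adicCompletion {p : ℕ} (hp : p.Prime) (hpv : (p : 𝓞 F) ∈ v.asIdeal) :
    ringChar 𝓀[v.adicCompletion F] = p := by
  have hlt : valuation (v.adicCompletion F) (p : v.adicCompletion F) < 1 :=
    LocalField.valuation_adicCompletion_natCast_lt_one v p hpv
  have hmem : ((p : ℕ) : 𝒪[v.adicCompletion F]) ∈ 𝓂[v.adicCompletion F] := by
    rw [mem_maximalIdeal_iff_valuation_lt_one]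
    exact_mod_cast hlt
  have h0 : ((p : ℕ) : 𝓀[v.adicCompletion F]) = 0 := by
    rw [← map_natCast (IsLocalRing.residue 𝒪[v.adicCompletion F]), IsLocalRing.residue_eq_zero_iff]
    exact hmem
  exact CharP.ringChar_of_prime_eq_zero hp h0

/-- `𝐍 v = p ^ f(v|p)` for the rational prime `p` under `v` (Mathlib `Ideal.absNorm_eq_pow_inertiaDeg'`).
[cite: NeukirchANT1999, Ch. I §8 Prop. (8.3)] -/
theorem residueCard_eq_pow_inertiaDeg {p : ℕ} (hp : p.Prime) (hpv : (p : 𝓞 F) ∈ v.asIdeal) :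
    v.residueCard = p ^ v.asIdeal.inertiaDeg ℤ := by
  have hpZ : (p : ℤ) ≠ 0 := Int.natCast_ne_zero.mpr hp.ne_zero
  haveI : v.asIdeal.IsMaximal := v.isMaximal
  have hmax : (Ideal.span {(p : ℤ)}).IsMaximal :=
    ((Ideal.span_singleton_prime hpZ).mpr (Nat.prime_iff_prime_int.mp hp)).isMaximal (by simpa using hpZ)
  haveI := hmax
  haveI : v.asIdeal.LiesOver (Ideal.span {(p : ℤ)}) := by
    refine ⟨hmax.eq_of_le (Ideal.comap_ne_top _ v.isMaximal.ne_top) ?_⟩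
    rw [Ideal.span_le, Set.singleton_subset_iff]
    change algebraMap ℤ (𝓞 F) (p : ℤ) ∈ v.asIdeal
    simpa using hpv
  rw [HeightOneSpectrum.residueCard, Ideal.absNorm_eq_pow_inertiaDeg' v.asIdeal hp,
    Ideal.inertiaDeg'_eq_inertiaDeg (Ideal.span {(p : ℤ)}) v.asIdeal]

end ResidueChar

/-! ### `Γ_{F_v} ≃ₜ* G_A` with the place pinned -/

section Pinned

variable (F : Type) [Field F] [NumberField F]

set_option synthInstance.maxHeartbeats 160000 in
/-- **`Γ_{F_v} ≅ G_A` as topological groups, with `v` THE place under `A`.**  For a valuation subring `A` of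
`F̄` and a prime `𝔓` of `\bar ℤ_F` above the finite place `v` with `𝔓 = 𝔪_A ∩ \bar ℤ_F`, there is an isomorphism
of topological groups `Gal(\bar F_v/F_v) ⥲ G_A ⊆ G_F`: `G_A = D_𝔓`
(`decompositionGroupNF_eq_decompositionSubgroup`), `𝔓 = σ • 𝔓₀` for the prime `𝔓₀` cut out by `F̄ → \bar F_v`
(transitivity), `D_{𝔓₀} = res(Γ_{F_v})` (Neukirch II (9.6)) with `res` injective and continuous, and
`σ · res(−) · σ⁻¹` is a continuous bijection from a compact group onto a Hausdorff one.  (Proof = abc-iut-L4-d2's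
`exists_continuousMulEquiv_decompositionGroupNF`, with the place exposed instead of ∃-bound.)
[cite: NeukirchANT1999, Ch. II §9 Prop. (9.6)] -/
theorem nonempty_continuousMulEquiv_decompositionGroupNF_of_mem_primesAbove
    (A : ValuationSubring (AlgebraicClosure F)) (v : HeightOneSpectrum (𝓞 F))
    (𝔓 : Ideal (absIntegers (𝓞 F) F)) (h𝔓v : 𝔓 ∈ v.primesAbove)
    (h𝔓 : ∀ s : absIntegers (𝓞 F) F, s ∈ 𝔓 ↔ (s : AlgebraicClosure F) ∈ A.nonunits) :
    Nonempty (absoluteGaloisGroup (v.adicCompletion F) ≃ₜ* decompositionGroupNF F A) := by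
  -- adapted from `exists_continuousMulEquiv_decompositionGroupNF` (abc-iut-L4-d2), place exposed
  haveI : CharZero (v.adicCompletion F) := LocalField.charZero_adicCompletion v
  -- `𝔓 = σ • 𝔓₀`
  obtain ⟨σ, hσ⟩ := HeightOneSpectrum.exists_smul_eq_of_mem_primesAbove_holds (K := F) (v := v)
    (adicCompletionPrime_mem_primesAbove F v) h𝔓v
  -- the continuous injective homomorphism `φ = σ · res(−) · σ⁻¹ : Γ_{F_v} → G_F`
  let res : absoluteGaloisGroup (v.adicCompletion F) →ₜ* absoluteGaloisGroup F :=
    absGaloisRestrict F (v.adicCompletion F)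
  let φ : absoluteGaloisGroup (v.adicCompletion F) →* absoluteGaloisGroup F :=
    (MulAut.conj σ).toMonoidHom.comp res.toMonoidHom
  have hφ_inj : Function.Injective φ := fun a b hab =>
    absGaloisRestrict_adicCompletion_injective F v ((MulAut.conj σ).injective hab)
  have hφ_cont : Continuous φ := by
    change Continuous fun x => σ * res x * σ⁻¹
    exact (res.continuous.const_mul σ).mul_const σ⁻¹
  -- its range is `G_A = D_𝔓 = D_{σ • 𝔓₀} = σ D_{𝔓₀} σ⁻¹ = σ res(Γ_{F_v}) σ⁻¹`
  have hrange : φ.range = decompositionGroupNF F A := by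
    rw [decompositionGroupNF_eq_decompositionSubgroup A 𝔓 h𝔓, ← hσ, Ideal.decompositionSubgroup_smul,
      decompositionSubgroup_adicCompletionPrime_eq_range F v]
    ext τ
    rw [MonoidHom.mem_range, Subgroup.mem_smul_pointwise_iff_exists]
    constructor
    · rintro ⟨x, rfl⟩
      exact ⟨res x, ⟨x, rfl⟩, rfl⟩
    · rintro ⟨y, ⟨x, rfl⟩, rfl⟩
      exact ⟨x, rfl⟩
  -- the group isomorphism onto the range, continuous from compact to Hausdorff
  let e : absoluteGaloisGroup (v.adicCompletion F) ≃* decompositionGroupNF F A :=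
    (MonoidHom.ofInjective hφ_inj).trans (MulEquiv.subgroupCongr hrange)
  have he : ∀ x, ((e x : decompositionGroupNF F A) : absoluteGaloisGroup F) = φ x := fun x => rfl
  have he_cont : Continuous e := by
    refine continuous_induced_rng.2 ?_
    have : (Subtype.val ∘ e) = φ := funext he
    rw [this]
    exact hφ_cont
  have he_symm_cont : Continuous e.symm :=
    Continuous.continuous_symm_of_equiv_compact_to_t2 (f := e.toEquiv) he_cont
  exact ⟨{ e with continuous_toFun := he_cont, continuous_invFun := he_symm_cont }⟩

omit [NumberField F] in
/-- The `𝓞_F`-level reading of «`v` is the place under `A`»: with `𝔓 = 𝔪_A ∩ \bar ℤ_F` above `v`, an element of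
`𝓞_F` lies in `𝔭_v` iff it is a non-unit of `A`. [cite: NeukirchANT1999, Ch. I §8 Prop. (8.3)] -/
theorem mem_asIdeal_iff_algebraMap_mem_nonunits (A : ValuationSubring (AlgebraicClosure F))
    (v : HeightOneSpectrum (𝓞 F)) (𝔓 : Ideal (absIntegers (𝓞 F) F)) (h𝔓v : 𝔓 ∈ v.primesAbove)
    (h𝔓 : ∀ s : absIntegers (𝓞 F) F, s ∈ 𝔓 ↔ (s : AlgebraicClosure F) ∈ A.nonunits) (x : 𝓞 F) :
    x ∈ v.asIdeal ↔ algebraMap (𝓞 F) (AlgebraicClosure F) x ∈ A.nonunits := by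
  have hunder : 𝔓.under (𝓞 F) = v.asIdeal := h𝔓v.2.over.symm
  rw [← hunder]
  exact h𝔓 (algebraMap (𝓞 F) (absIntegers (𝓞 F) F) x)

end Pinned

/-! ### Local invariants along an isomorphism of decomposition groups -/

section TwoFields

variable {F₁ : Type} [Field F₁] [NumberField F₁] {F₂ : Type} [Field F₂] [NumberField F₂]
  {A₁ : ValuationSubring (AlgebraicClosure F₁)} {v₁ : HeightOneSpectrum (𝓞 F₁)}
  {𝔓₁ : Ideal (absIntegers (𝓞 F₁) F₁)} (h𝔓v₁ : 𝔓₁ ∈ v₁.primesAbove)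
  (h𝔓₁ : ∀ s : absIntegers (𝓞 F₁) F₁, s ∈ 𝔓₁ ↔ (s : AlgebraicClosure F₁) ∈ A₁.nonunits)
  {A₂ : ValuationSubring (AlgebraicClosure F₂)} {v₂ : HeightOneSpectrum (𝓞 F₂)}
  {𝔓₂ : Ideal (absIntegers (𝓞 F₂) F₂)} (h𝔓v₂ : 𝔓₂ ∈ v₂.primesAbove)
  (h𝔓₂ : ∀ s : absIntegers (𝓞 F₂) F₂, s ∈ 𝔓₂ ↔ (s : AlgebraicClosure F₂) ∈ A₂.nonunits)
  (α : decompositionGroupNF F₁ A₁ ≃ₜ* decompositionGroupNF F₂ A₂)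

include h𝔓v₁ h𝔓₁ h𝔓v₂ h𝔓₂ α in
/-- The transported isomorphism `Γ_{(F₁)_{v₁}} ≃ₜ* Γ_{(F₂)_{v₂}}` of absolute Galois groups of the completions.
[cite: NeukirchSchmidtWingberg2008, Ch. XII §2 (12.2.1)] -/
theorem nonempty_continuousMulEquiv_absoluteGaloisGroup_adicCompletion :
    Nonempty (absoluteGaloisGroup (v₁.adicCompletion F₁) ≃ₜ* absoluteGaloisGroup (v₂.adicCompletion F₂)) := by
  obtain ⟨e₁⟩ := nonempty_continuousMulEquiv_decompositionGroupNF_of_mem_primesAbove F₁ A₁ v₁ 𝔓₁ h𝔓v₁ h𝔓₁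
  obtain ⟨e₂⟩ := nonempty_continuousMulEquiv_decompositionGroupNF_of_mem_primesAbove F₂ A₂ v₂ 𝔓₂ h𝔓v₂ h𝔓₂
  exact ⟨e₁.trans (α.trans e₂.symm)⟩

include h𝔓v₁ h𝔓₁ h𝔓v₂ h𝔓₂ α in
/-- **(P3) The residue characteristic is preserved** ([AbsAnab] Prop. 1.2.1 (i) «`p₁ = p₂`» applied to
`Γ_{(F₁)_{v₁}} ≅ G_{A₁} ≅ G_{A₂} ≅ Γ_{(F₂)_{v₂}}`): a rational prime lies under `v₁` iff it lies under `v₂`.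
[cite: MochizukiAbsAnab2004, Prop 1.2.1 (i) p.10] -/
theorem natCast_mem_asIdeal_iff_of_decompositionGroupNF_equiv {p : ℕ} (hp : p.Prime) :
    (p : 𝓞 F₁) ∈ v₁.asIdeal ↔ (p : 𝓞 F₂) ∈ v₂.asIdeal := by
  obtain ⟨p₁, hp₁, hp₁v⟩ := exists_prime_natCast_mem_asIdeal v₁
  obtain ⟨p₂, hp₂, hp₂v⟩ := exists_prime_natCast_mem_asIdeal v₂
  haveI : Fact p₁.Prime := ⟨hp₁⟩
  haveI : Fact p₂.Prime := ⟨hp₂⟩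
  letI : Algebra ℚ_[p₁] (v₁.adicCompletion F₁) := LocalField.adicCompletionPadicAlgebra v₁ p₁ hp₁v
  letI : Algebra ℚ_[p₂] (v₂.adicCompletion F₂) := LocalField.adicCompletionPadicAlgebra v₂ p₂ hp₂v
  haveI : FiniteDimensional ℚ_[p₁] (v₁.adicCompletion F₁) := by
    apply Module.finite_of_finrank_pos
    rw [← RescaledCompletion.localDeg_eq_finrank F₁ p₁ v₁ hp₁v]
    exact localDeg_pos F₁ v₁
  haveI : FiniteDimensional ℚ_[p₂] (v₂.adicCompletion F₂) := by
    apply Module.finite_of_finrank_pos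
    rw [← RescaledCompletion.localDeg_eq_finrank F₂ p₂ v₂ hp₂v]
    exact localDeg_pos F₂ v₂
  have h12 : p₁ = p₂ := galoisMLF_iso_residueChar_eq_holds p₁ p₂ (v₁.adicCompletion F₁) (v₂.adicCompletion F₂)
    (nonempty_continuousMulEquiv_absoluteGaloisGroup_adicCompletion h𝔓v₁ h𝔓₁ h𝔓v₂ h𝔓₂ α)
  constructor
  · intro h
    rw [eq_of_prime_natCast_mem_asIdeal v₁ hp hp₁ h hp₁v, h12]
    exact hp₂v
  · intro h
    rw [eq_of_prime_natCast_mem_asIdeal v₂ hp hp₂ h hp₂v, ← h12]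
    exact hp₁v

include h𝔓v₁ h𝔓₁ h𝔓v₂ h𝔓₂ α in
/-- **(P4) The local degree and the residue cardinality are preserved** ([AbsAnab] Prop. 1.2.1 (v)
«`[K₁ : ℚ_p] = [K₂ : ℚ_p]`, `[k₁ : 𝔽_p] = [k₂ : 𝔽_p]`» at the canonical `ℚ_p`-structures of the completions):
`n_{v₁} = n_{v₂}` and `𝐍 v₁ = 𝐍 v₂`. [cite: MochizukiAbsAnab2004, Prop 1.2.1 (v) p.10] -/
theorem localDeg_eq_and_residueCard_eq_of_decompositionGroupNF_equiv :
    localDeg F₁ v₁ = localDeg F₂ v₂ ∧ v₁.residueCard = v₂.residueCard := by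
  obtain ⟨p, hp, hpv₁⟩ := exists_prime_natCast_mem_asIdeal v₁
  have hpv₂ : (p : 𝓞 F₂) ∈ v₂.asIdeal :=
    (natCast_mem_asIdeal_iff_of_decompositionGroupNF_equiv h𝔓v₁ h𝔓₁ h𝔓v₂ h𝔓₂ α hp).mp hpv₁
  haveI : Fact p.Prime := ⟨hp⟩
  letI : Algebra ℚ_[p] (v₁.adicCompletion F₁) := LocalField.adicCompletionPadicAlgebra v₁ p hpv₁
  letI : Algebra ℚ_[p] (v₂.adicCompletion F₂) := LocalField.adicCompletionPadicAlgebra v₂ p hpv₂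
  haveI : FiniteDimensional ℚ_[p] (v₁.adicCompletion F₁) := by
    apply Module.finite_of_finrank_pos
    rw [← RescaledCompletion.localDeg_eq_finrank F₁ p v₁ hpv₁]
    exact localDeg_pos F₁ v₁
  haveI : FiniteDimensional ℚ_[p] (v₂.adicCompletion F₂) := by
    apply Module.finite_of_finrank_pos
    rw [← RescaledCompletion.localDeg_eq_finrank F₂ p v₂ hpv₂]
    exact localDeg_pos F₂ v₂
  obtain ⟨hdeg, hres⟩ := galoisMLF_iso_degrees_holds p p (v₁.adicCompletion F₁) (v₂.adicCompletion F₂)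
    (nonempty_continuousMulEquiv_absoluteGaloisGroup_adicCompletion h𝔓v₁ h𝔓₁ h𝔓v₂ h𝔓₂ α)
  refine ⟨?_, ?_⟩
  · rw [RescaledCompletion.localDeg_eq_finrank F₁ p v₁ hpv₁, RescaledCompletion.localDeg_eq_finrank F₂ p v₂ hpv₂]
    exact hdeg
  · rw [← Literature.NumberTheory.Automorphic.residueFieldCard_adicCompletion_eq F₁ v₁,
      ← Literature.NumberTheory.Automorphic.residueFieldCard_adicCompletion_eq F₂ v₂,
      ← residueCardMLF_eq_residueFieldCard (ringChar_residueField_adicCompletion v₁ hp hpv₁),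
      ← residueCardMLF_eq_residueFieldCard (ringChar_residueField_adicCompletion v₂ hp hpv₂)]
    exact hres

include h𝔓v₁ h𝔓₁ h𝔓v₂ h𝔓₂ α in
/-- **The local degrees agree**: `n_{v₁} = e₁ f₁ = e₂ f₂ = n_{v₂}`. [cite: MochizukiAbsAnab2004, Prop 1.2.1 (v) p.10] -/
theorem localDeg_eq_of_decompositionGroupNF_equiv : localDeg F₁ v₁ = localDeg F₂ v₂ :=
  (localDeg_eq_and_residueCard_eq_of_decompositionGroupNF_equiv h𝔓v₁ h𝔓₁ h𝔓v₂ h𝔓₂ α).1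

include h𝔓v₁ h𝔓₁ h𝔓v₂ h𝔓₂ α in
/-- **The residue cardinalities agree**: `𝐍 v₁ = 𝐍 v₂`. [cite: MochizukiAbsAnab2004, Prop 1.2.1 (v) p.10] -/
theorem residueCard_eq_of_decompositionGroupNF_equiv : v₁.residueCard = v₂.residueCard :=
  (localDeg_eq_and_residueCard_eq_of_decompositionGroupNF_equiv h𝔓v₁ h𝔓₁ h𝔓v₂ h𝔓₂ α).2

include h𝔓v₁ h𝔓₁ h𝔓v₂ h𝔓₂ α in
/-- **The residue degrees agree**: `f(v₁|p) = f(v₂|p)` (from `𝐍 v = p^f` at the common residue characteristic).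
[cite: MochizukiAbsAnab2004, Prop 1.2.1 (v) p.10] -/
theorem inertiaDeg_eq_of_decompositionGroupNF_equiv :
    v₁.asIdeal.inertiaDeg ℤ = v₂.asIdeal.inertiaDeg ℤ := by
  obtain ⟨p, hp, hpv₁⟩ := exists_prime_natCast_mem_asIdeal v₁
  have hpv₂ : (p : 𝓞 F₂) ∈ v₂.asIdeal :=
    (natCast_mem_asIdeal_iff_of_decompositionGroupNF_equiv h𝔓v₁ h𝔓₁ h𝔓v₂ h𝔓₂ α hp).mp hpv₁
  have h := residueCard_eq_of_decompositionGroupNF_equiv h𝔓v₁ h𝔓₁ h𝔓v₂ h𝔓₂ α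
  rw [residueCard_eq_pow_inertiaDeg v₁ hp hpv₁, residueCard_eq_pow_inertiaDeg v₂ hp hpv₂] at h
  exact Nat.pow_right_injective hp.two_le h

include h𝔓v₁ h𝔓₁ h𝔓v₂ h𝔓₂ α in
/-- **The ramification indices agree**: `e(v₁|p) = e(v₂|p)` (from `n_v = e f` and `f₁ = f₂ > 0`).
[cite: MochizukiAbsAnab2004, Prop 1.2.1 (v) p.10] -/
theorem ramificationIdx_eq_of_decompositionGroupNF_equiv :
    v₁.asIdeal.ramificationIdx ℤ = v₂.asIdeal.ramificationIdx ℤ := by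
  have hn := localDeg_eq_of_decompositionGroupNF_equiv h𝔓v₁ h𝔓₁ h𝔓v₂ h𝔓₂ α
  have hf := inertiaDeg_eq_of_decompositionGroupNF_equiv h𝔓v₁ h𝔓₁ h𝔓v₂ h𝔓₂ α
  unfold localDeg at hn
  rw [hf] at hn
  exact Nat.eq_of_mul_eq_mul_right (Ideal.inertiaDeg_pos _ _) hn

end TwoFields

/-! ### The `A ≠ ⊤` packaging (places chosen by `exists_ideal_mem_primesAbove_of_ne_top`) -/

section Packaged

variable (F₁ : Type) [Field F₁] [NumberField F₁] (F₂ : Type) [Field F₂] [NumberField F₂]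

/-- **R2, packaged.**  For nontrivial valuation subrings `A₁` of `\bar F₁` and `A₂` of `\bar F₂` whose
decomposition groups are isomorphic as topological groups, the finite places `v₁`, `v₂` under them (in the sense
`𝔭_{vᵢ} = 𝔪_{Aᵢ} ∩ 𝓞_{Fᵢ}`) have the same residue characteristic, the same local degree, the same residue
cardinality, the same residue degree and the same ramification index.
[cite: NeukirchSchmidtWingberg2008, Ch. XII §2 (12.2.1)] -/
theorem exists_places_invariants_of_decompositionGroupNF_equiv
    (A₁ : ValuationSubring (AlgebraicClosure F₁)) (hA₁ : A₁ ≠ ⊤)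
    (A₂ : ValuationSubring (AlgebraicClosure F₂)) (hA₂ : A₂ ≠ ⊤)
    (α : decompositionGroupNF F₁ A₁ ≃ₜ* decompositionGroupNF F₂ A₂) :
    ∃ (v₁ : HeightOneSpectrum (𝓞 F₁)) (v₂ : HeightOneSpectrum (𝓞 F₂)),
      (∀ x : 𝓞 F₁, x ∈ v₁.asIdeal ↔ algebraMap (𝓞 F₁) (AlgebraicClosure F₁) x ∈ A₁.nonunits) ∧
      (∀ x : 𝓞 F₂, x ∈ v₂.asIdeal ↔ algebraMap (𝓞 F₂) (AlgebraicClosure F₂) x ∈ A₂.nonunits) ∧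
      (∀ p : ℕ, p.Prime → ((p : 𝓞 F₁) ∈ v₁.asIdeal ↔ (p : 𝓞 F₂) ∈ v₂.asIdeal)) ∧
      localDeg F₁ v₁ = localDeg F₂ v₂ ∧ v₁.residueCard = v₂.residueCard ∧
      v₁.asIdeal.inertiaDeg ℤ = v₂.asIdeal.inertiaDeg ℤ ∧
      v₁.asIdeal.ramificationIdx ℤ = v₂.asIdeal.ramificationIdx ℤ := by
  obtain ⟨v₁, 𝔓₁, h𝔓v₁, h𝔓₁⟩ := exists_ideal_mem_primesAbove_of_ne_top A₁ hA₁
  obtain ⟨v₂, 𝔓₂, h𝔓v₂, h𝔓₂⟩ := exists_ideal_mem_primesAbove_of_ne_top A₂ hA₂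
  exact ⟨v₁, v₂, mem_asIdeal_iff_algebraMap_mem_nonunits F₁ A₁ v₁ 𝔓₁ h𝔓v₁ h𝔓₁,
    mem_asIdeal_iff_algebraMap_mem_nonunits F₂ A₂ v₂ 𝔓₂ h𝔓v₂ h𝔓₂,
    fun p hp => natCast_mem_asIdeal_iff_of_decompositionGroupNF_equiv h𝔓v₁ h𝔓₁ h𝔓v₂ h𝔓₂ α hp,
    localDeg_eq_of_decompositionGroupNF_equiv h𝔓v₁ h𝔓₁ h𝔓v₂ h𝔓₂ α,
    residueCard_eq_of_decompositionGroupNF_equiv h𝔓v₁ h𝔓₁ h𝔓v₂ h𝔓₂ α,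
    inertiaDeg_eq_of_decompositionGroupNF_equiv h𝔓v₁ h𝔓₁ h𝔓v₂ h𝔓₂ α,
    ramificationIdx_eq_of_decompositionGroupNF_equiv h𝔓v₁ h𝔓₁ h𝔓v₂ h𝔓₂ α⟩

end Packaged

end NeukirchUchidaProof

end Literature.AnabelianGeometry.AbsoluteAnabelian
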